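import Literature.NumberTheory.LFunctions.Zhang2022.RepairRplusPlus
import Literature.NumberTheory.LFunctions.Zhang2022.RepairWallBand
import Literature.NumberTheory.LFunctions.Zhang2022.RepairJumpBlock
import Literature.NumberTheory.LFunctions.Zhang2022.RepairDetShift
import Literature.NumberTheory.LFunctions.Zhang2022.KnifeEdgeThreePiece
import Literature.NumberTheory.LFunctions.Zhang2022.RepairFarBV
import Literature.NumberTheory.LFunctions.Zhang2022.RepairLambdaBlock
import Literature.NumberTheory.LFunctions.Zhang2022.RepairIntakeBmulti
import Literature.NumberTheory.LFunctions.Zhang2022.RepairIntakeBlen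

/-!
# Zhang (2022) §18-margin repair rung — THE RUNNING ASSEMBLY `R⁺⁺`, continuation file (versions 4, …)

Trunk T-ANT (NumberTheory/LFunctions). Y. Zhang, *Discrete mean estimates and the Landau–Siegel
zero*, arXiv:2211.02515v1 (2022) [Zhang2022LandauSiegel] — **an unrefereed manuscript under
adjudication. WHAT THIS IS NOT: nothing here asserts or denies its Theorems 1–2 or any analytic lemma;
no claim about Landau–Siegel zeros, about Parity, or about a repaired `Margin232` is made. Every
statement is about the manuscript's METHOD AS ARCHITECTED — classes of designs fed to the SAME main-term
calculus (or to a displayed MODEL main term) — not about zeros of `L`-functions.** Cell `landau-siegel`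
(rung F-S3), sub-cell E, seat p1, stub S-E-p1-1 «running assembly» of barrier/ASSIGNMENTS.md.

Continuation of `RepairRplusPlus` (versions 0–3; that file reached its 400-line budget): same protocol
(`Repair.DesignFamily`, `ClassDecided`, append-only versions `Rplusplus<k>`, class OF RECORD = the last
version, named in barrier/BARRIER-STATE.md; each version: `Rplusplus<k>`, `rplusplus<k>_decided` by
`classDecided_append` — nothing re-proved —, `mem_rplusplus<k>_iff`, the prefix lemma, the sub-list
recoveries of the slice files' own partial assemblies, the unbundled verdicts, and the table rows in a
`/-! ### Version k -/` section).

## Class table — version 4 (rows 15–19; rows 1–14 in `RepairRplusPlus`)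

| # | family (decl) | designs, K in words | V (currency) | displayed inputs (kind) | p-id (file) | non-vacuity / tightness / embeddings |
|---|---|---|---|---|---|---|
| 15 | `KnifeEdge.familyWallBand` | `(u, u′, W : KnifeEdge.WallData)` with `Repair.KinkedProfile u u′`: kinked `H¹` bulk on `[0,1]`, wall value `u(1)` FREE, band/wall data `W` (B-multi M3 «wall/band», the object of record truncated at the wall; no analytic hypothesis) | MODEL main-term currency (E-034): `¬ (wallMainTerm K X u u′ W < 0)`, `wallMainTerm = 𝔅(u) + 2Re X(u,W) + ‖h⁺‖²K[b]`; the bulk `𝔅(u)` at `u(1⁻) ≠ 0` is the MODEL's bulk, not the (4.1)-dictionary value (guard G1 / Q→theory-3) | both quantified INSIDE the verdict: band sign `∀ b, 0 ≤ K b` (E-005/E-034, (B1); discharged for `bandK`) · `WallCrossCS K X` (E-006, kind (c); the DISCRETE-level CS is a theorem, p459102 `norm_sq_discPolar_le`; the model-level slot is the dictionary content) | p459421 (`RepairWallBand`) ← p458037, p459102 | C4 `familyWallBand_inClass_constOne_flat` (`u ≡ 1`, `u(1) ≠ 0`), `familyWallBand_inClass_gStar_flat`; C2 `wallMainTerm_sharpCut_of_cs`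 (sharp cut, `X` forced `0`: the object is `𝔅(u)`), `familyWallBand_inClass_of_inClassPiece`; REF-E E-10 PASS (model currency; counted separately from row 7's X-world coverage) |
| 16 | `familyJumpBlockAll` | `(κ, J) : (ℝ → ℝ) × KnifeEdge.JumpData` with `J.Admissible` (B-multi M1: kinked bulk + finitely many interior jumps `(z_i, c_i)`, `z_i ∈ (0,1)`); the underived jump kernel `κ` is a COORDINATE of the design (kernel-uniform packaging of `familyJumpBlock κ`, `familyJumpBlockAll_iff`) | balanced MODEL main term (E-028): `0 ≤ jumpMainTerm κ J = 𝔅(u) + Σ‖c_i‖²κ(z_i)` | kernel sign `∀ z ∈ (0,1), 0 ≤ κ z` (E-028; outright under `KnifeEdge.JumpKernelPos κ`) | p460685 (`RepairJumpBlock`) ← p458438 | C4 `jumpOne`/`jumpTwo` (`admissible_jumpOne`, …; multi-jump-001/002 shapes); tightness `jumpMainTerm_jumpStar : jumpMainTerm κ jumpStar = κ(1/2)` (so `κ(1/2) < 0` closes); C2 `jumpMainTerm_of_isEmpty` (no jumps: row 2's `𝔅(u)`); C4 also `admissible_jumpBPRZ` (multi-jump-003, p461514); REF-E E-11 PASS —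 finite `J`, `u(1) = 0` declared; the LITERAL fixed-height jump reading is UNCOVERED by any theorem |
| 17 | `familyDetShift` | `DetShiftDesign (b; u,u′; f,f′)`: `Det.SignAdmissible b ∧ Det.InShiftBox b` (W2 shift detectors `|S| = 3` in the admissible box — the det KILL-class text F-det-8(a)(iii) verbatim) ∧ one-sided kinked legs with `u(1) = f(1) = 0` | FormDet currency (formula I of the detector's recipe, one-sided legs): `¬ (FormDet_b(u)·FormDet_b(f) < ‖FormDetPolar_b(u,f)‖²)` | `Det.FormDetPSD (Det.shiftRecipe b)` (E-010, kind (c); conjecture-shaped off `b = (1,2,3)`, discharged at std by `Det.formDetPSD_shiftRecipe_std`; numerical evidence E-CERT-001 kit j257689 at `(½; 5/2, 13/5)`, docstring only) | p460173 (`RepairDetShift`) ← p456255, p456292 | C2 `detShift_std_toH1` / `detShift_std_verdict_iff` (at `b = (1,2,3)` the verdict IS row 2's); REF-E E-9 PASS, CONDITIONAL off std |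
| 18 | `KnifeEdge.familyRoughThreePiece` | (M3-overhang, several in-class scalars; REF-E E-12) `KnifeEdge.ThreePieceDesign`: `1 ≤ θ`, TWO in-class pieces `u`, `f` (`InClassPiece`) with independent scalars `s`, `t`, `RoughOverhangPiece θ v v′` | X-world POS for the three-piece design: `¬ (twoPieceMainTerm θ X (s·u+t·f) (s·u′+t·f′) v v′ 1 < 0)` (continued calculus; E-017 / E-002 open) | row 7's two slots as WORLD binders: `BandNonnegOn (RoughOverhangPiece θ) θ X` (E-005) · `CrossSubordinateOn …` (E-006) — they quantify over the in-class SUBSPACE (`InClassPiece.add_smul`) | p461544 (`KnifeEdgeThreePiece`) ← p457552 | RETIRES row 7's declared exclusion «several in-class pieces with independent scalars»; C4 `familyRoughThreePiece_inClass_witness` (`g⋆`, `ϰ_{1,5/2}`, plateau); slots inhabited/load-bearing as row 7 |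
| 19 | `KnifeEdge.familyRoughTwoPieceJoint` | (M3-overhang, JOINT currency; REF-E E-12) `Repair.JointDesign` with ROUGH overhang: `1 ≤ θ`, `InClassPiece u u′`, `RoughOverhangPiece θ v v′`, in-class probe `InClassPiece f f′` | JOINT T-true on the rough class: `¬ (twoPieceMainTerm θ X u u′ v v′ s·𝔅(f) < ‖twoPieceCross θ X u u′ v v′ s f f′‖²)` (continued calculus; E-017 / E-002 open) | as WORLD binders: `KnifeEdge.WorldLinearOn (RoughOverhangPiece θ) X` (displayed CONSISTENCY condition of p442741's scalar convention: worlds linear in the in-class slot — not an estimate; `worldLinearOn_zero`, `worldLinearOn_of_invisible`) · `BandNonnegOn` (E-005) · `CrossSubordinateOn` (E-006) | p461544 | threshold `KnifeEdge.pencil_neg_iff`; the three hypotheses jointly INHABITED (`exists_linear_slots_rough`, a linear cancelling world) and LOAD-BEARING (`familyRoughTwoPieceJoint_slots_loadBearing`: at the linear world `X = 0` the criterion closes on a member — `Repair.jointCloses_zero` — and E-006 fails); C2 `familyTwoPieceJoint_inClass_toRough` (row 11 ⊆ row 19), `not_jointCloses_of_invisible_again` |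

C1 NOTES on earlier rows (referee flags to be read WITH the rows of `RepairRplusPlus`; append-only there):
* rows 12–13 `familyWallZero` / `familyWallZeroTop` (p459259): «CONDITIONAL on E-004 (`Repair.DiscMeanBandWidthWall0`)»
  — the analytic band-width slot, whose inhabitation for some `C` is the registry row itself (REF-E E-8);
* row 14 `familyInPrintLen` (p459189): «NON-COVERING (vacuous beyond the wall; slot refuted for `ν₁ ≥ 1`,
  `not_inPrintOffDiagonalRange_thetaLen`)» — its content is the threshold `inPrintOffDiagonalRange_iff_belowP` (the
  printed off-diagonal range is exactly the wall; REF-E T-2); the «lengths ≥ P» class stays UNCOVERED in `R⁺⁺`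
  (E*-len input E-001 / E-002 needed);
* row 7 `KnifeEdge.familyRoughTwoPiece`: of its declared exclusions (quoted in `RepairRplusPlus` v3), «several in-class
  pieces with independent scalars» is now COVERED by row 18 with the same slots; the others stand.

KILL-word alignment (REF-E C1): the §B-multi word landed 2026-08-26T18:10Z (director) — its intake (sum design type
over the sub-classes M0/M1/M2/M3/far-BV/mixed, C1 docstring = the word verbatim) is p3's `RepairIntakeBmulti.lean`
(S-E-p3-4), which imports the families of rows 2, 7, 15, 16 (+ `familyLambdaBlock`, `familyFarBV`, `familyGramBlock`
when landed); this file records the running UNION, not the word.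

## References

* Y. Zhang, arXiv:2211.02515v1 (2022), §2 Lemma 2.3, Props. 2.4–2.6, (2.13), (2.16)–(2.20), (2.32)–(2.33)
  [p. 4–11], §7 Prop. 7.1, (7.2) [p. 44], §8 Lemma 8.1, (8.11)–(8.12), §10 (10.5).
  [cite: Zhang2022LandauSiegel, §§2, 7, 8, 10]
-/

noncomputable section

namespace Literature.NumberTheory.LFunctions.Zhang2022

namespace Repair

/-! ### Version 4 (2026-08-26): five more decided families -/

/-- **`R⁺⁺`, version 4**: version 3 (`RepairRplusPlus.Rplusplus3`, 14 families) followed by the wall/band family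
(`KnifeEdge.familyWallBand`, p459421), the interior-jump family for all kernels (`familyJumpBlockAll`, p460685), the
shift-detector family (`familyDetShift`, p460173) and the two three-piece / rough-joint families
(`KnifeEdge.familyRoughThreePiece`, `KnifeEdge.familyRoughTwoPieceJoint`, p461544) — rows 15–19 of the table above.
[cite: Zhang2022LandauSiegel, §2 (2.13), (2.32)–(2.33); §7 (7.2) p.44; §10 (10.5)] -/
def Rplusplus4 : List DesignFamily :=
  Rplusplus3 ++ [KnifeEdge.familyWallBand, familyJumpBlockAll, familyDetShift, KnifeEdge.familyRoughThreePiece,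
    KnifeEdge.familyRoughTwoPieceJoint]

/-- **Version 4 is decided**: `rplusplus3_decided` for rows 1–14 and the five landed `…_decided` theorems for rows
15–19; nothing re-proved. [cite: Zhang2022LandauSiegel, §2 Props. 2.4–2.6, (2.32)–(2.33); §7 (7.2) p.44] -/
theorem rplusplus4_decided : ClassDecided Rplusplus4 :=
  classDecided_append.2
    ⟨rplusplus3_decided,
      classDecided_cons KnifeEdge.familyWallBand_decided <| classDecided_cons familyJumpBlockAll_decided <|
        classDecided_cons familyDetShift_decided <| classDecided_cons KnifeEdge.familyRoughThreePiece_decided <|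
          classDecided_cons KnifeEdge.familyRoughTwoPieceJoint_decided classDecided_nil⟩

/-- The families of version 4, by name (the class is EXACTLY these nineteen).
[cite: Zhang2022LandauSiegel, §2 (2.32)–(2.33)] -/
theorem mem_rplusplus4_iff (F : DesignFamily) :
    F ∈ Rplusplus4 ↔ F = familyR ∨ F = familyH1 ∨ F = familyTwoPiece ∨ F = familyFarPiece ∨
      F = familyRWide ∨ F = familyRCalc ∨ F = KnifeEdge.familyRoughTwoPiece ∨ F = familyRLengths ∨
      F = familySmoothLengths ∨ F = familySmoothTop ∨ F = familyTwoPieceJoint ∨ F = familyWallZero ∨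
      F = familyWallZeroTop ∨ F = familyInPrintLen ∨ F = KnifeEdge.familyWallBand ∨ F = familyJumpBlockAll ∨
      F = familyDetShift ∨ F = KnifeEdge.familyRoughThreePiece ∨ F = KnifeEdge.familyRoughTwoPieceJoint := by
  simp only [Rplusplus4, Rplusplus3, Rplusplus2, Rplusplus1, Rplus, List.cons_append, List.nil_append,
    List.mem_cons, List.not_mem_nil, or_false]

/-- **Version 3 ⊆ version 4** (list prefix: no family dropped). [cite: Zhang2022LandauSiegel, §2 (2.32)–(2.33)] -/
theorem rplusplus3_sub_rplusplus4 : ∀ F ∈ Rplusplus3, F ∈ Rplusplus4 :=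
  fun _ hF => List.mem_append.2 (Or.inl hF)

/-- `R⁺ ⊆` version 4. [cite: Zhang2022LandauSiegel, §2 (2.32)–(2.33)] -/
theorem rplus_sub_rplusplus4 : ∀ F ∈ Rplus, F ∈ Rplusplus4 :=
  fun F hF => rplusplus3_sub_rplusplus4 F (rplus_sub_rplusplus3 F hF)

/-- Version 4 restricted to version 3 (consistency of the bookkeeping). [cite: Zhang2022LandauSiegel, §2 (2.32)–(2.33)] -/
theorem rplusplus4_decided_restrict : ClassDecided Rplusplus3 := rplusplus4_decided.mono rplusplus3_sub_rplusplus4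

/-- The slice files' partial assemblies are instances of version 4: `R⁺ ++ [wall/band]` (`KnifeEdge.rplus_wallBand_decided`),
`R⁺ ++ [M1, all kernels]` (`rplus_jumpAll_decided`), `R⁺ ++ [det shift]` (`rplus_detShift_decided`),
`R⁺ ++ [three-piece, rough joint]` (`KnifeEdge.rplus_threePiece_decided`) are sub-lists. [cite: Zhang2022LandauSiegel, §2 (2.32)–(2.33)] -/
theorem rplusplus4_decided_sublists :
    ClassDecided (Rplus ++ [KnifeEdge.familyWallBand]) ∧ ClassDecided (Rplus ++ [familyJumpBlockAll]) ∧
      ClassDecided (Rplus ++ [familyDetShift]) ∧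
      ClassDecided (Rplus ++ [KnifeEdge.familyRoughThreePiece, KnifeEdge.familyRoughTwoPieceJoint]) := by
  refine ⟨rplusplus4_decided.mono fun F hF => ?_, rplusplus4_decided.mono fun F hF => ?_,
    rplusplus4_decided.mono fun F hF => ?_, rplusplus4_decided.mono fun F hF => ?_⟩ <;>
  · simp only [Rplus, List.cons_append, List.nil_append, List.mem_cons, List.not_mem_nil, or_false,
      mem_rplusplus4_iff] at hF ⊢
    tauto

/-- **Unbundled reading of rows 15–19** (what version 4 adds): the wall/band model verdict, the interior-jump model
verdict for every kernel, the shift-detector verdict with its PSD slot, the three-piece verdict and the rough joint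
verdict — each with its displayed hypotheses as literal binders. [cite: Zhang2022LandauSiegel, §2 Props. 2.4–2.6, (2.32)–(2.33); §7 (7.2) p.44; §10 (10.5)] -/
theorem rplusplus4_verdicts :
    (∀ (u u' : ℝ → ℂ) (W : KnifeEdge.WallData), KinkedProfile u u' →
        ∀ (K : (ℝ → ℂ) → ℝ) (X : KnifeEdge.WallCross), (∀ b : ℝ → ℂ, 0 ≤ K b) → KnifeEdge.WallCrossCS K X →
          ¬ (KnifeEdge.wallMainTerm K X u u' W < 0)) ∧
    (∀ (κ : ℝ → ℝ) (J : KnifeEdge.JumpData), J.Admissible → (∀ z ∈ Set.Ioo (0:ℝ) 1, 0 ≤ κ z) →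
        0 ≤ KnifeEdge.jumpMainTerm κ J) ∧
    (∀ d : DetShiftDesign, d.InClass → d.Verdict) ∧
    (∀ (θ : ℝ) (u u' f f' v v' : ℝ → ℂ) (s t : ℂ), 1 ≤ θ → KnifeEdge.InClassPiece u u' →
        KnifeEdge.InClassPiece f f' → KnifeEdge.RoughOverhangPiece θ v v' → ∀ X : KnifeEdge.PairFunctional,
          KnifeEdge.BandNonnegOn (KnifeEdge.RoughOverhangPiece θ) θ X →
            KnifeEdge.CrossSubordinateOn (KnifeEdge.RoughOverhangPiece θ) θ X →
              ¬ (KnifeEdge.twoPieceMainTerm θ X (fun x => s * u x + t * f x) (fun x => s * u' x + t * f' x)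
                    v v' 1 < 0)) ∧
    (∀ (θ : ℝ) (u u' v v' : ℝ → ℂ) (s : ℂ) (f f' : ℝ → ℂ), 1 ≤ θ → KnifeEdge.InClassPiece u u' →
        KnifeEdge.RoughOverhangPiece θ v v' → KnifeEdge.InClassPiece f f' → ∀ X : KnifeEdge.PairFunctional,
          KnifeEdge.WorldLinearOn (KnifeEdge.RoughOverhangPiece θ) X →
            KnifeEdge.BandNonnegOn (KnifeEdge.RoughOverhangPiece θ) θ X →
              KnifeEdge.CrossSubordinateOn (KnifeEdge.RoughOverhangPiece θ) θ X →
                ¬ (KnifeEdge.twoPieceMainTerm θ X u u' v v' s * mainTermForm f f'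
                    < ‖twoPieceCross θ X u u' v v' s f f'‖ ^ 2)) :=
  ⟨fun u u' W hu K X hK hX => KnifeEdge.familyWallBand_decided (u, u', W) hu K X hK hX,
    fun κ J hJ hκ => familyJumpBlockAll_decided (κ, J) hJ hκ,
    fun d h => familyDetShift_decided d h,
    fun θ u u' f f' v v' s t hθ hu hf hv X hB hC =>
      KnifeEdge.familyRoughThreePiece_decided ⟨θ, u, u', f, f', v, v', s, t⟩ ⟨hθ, hu, hf, hv⟩ X hB hC,
    fun θ u u' v v' s f f' hθ hu hv hf X hX hB hC =>
      KnifeEdge.familyRoughTwoPieceJoint_decided ⟨θ, u, u', v, v', s, f, f'⟩ ⟨hθ, hu, hv, hf⟩ X hX hB hC⟩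

/-! ### Version 5 (2026-08-26): the far bounded-variation family

| # | family (decl) | designs, K in words | V (currency) | displayed inputs (kind) | p-id (file) | non-vacuity / tightness / embeddings |
|---|---|---|---|---|---|---|
| 20 | `familyFarBV` | `FarBVData (c′, δ, ε, B, V, g)`: `0 < ε < δ`, `0 ≤ B`, `0 ≤ V`, `‖g‖ ≤ B` everywhere, `eVariationOn g [1, 1+δ] ≤ V` — the E-033 hypotheses VERBATIM (B-multi (L-a.iii): far bounded-variation structure beyond the wall — jumps, sharp cut-offs, steps, PPE blocks; B-len's far pieces likewise) | discrete mean: no main-order gain `P^{1+ε} → P^{1+δ}` (bound `P^{−ε/8}(discMeanAbs⌈P^{1+ε}⌉ + (B+V)²·discWeight)`) — DECIDED BY THEOREM E-033 (`KnifeEdgeDiscMeanFlat.discMeanFlat_bv`, p457806; engine `tailInvisible_bv`, p457577); NO slot | `Re ρ = ½` on `Skeleton.idx χ` (b) only | p463265 (`RepairFarBV`) ← p457806, p457577 | C2 row 4 ⊆ row 20: `farPiece_toFarBV`, `farBV_verdict_of_farPiece_verdict` (a 1-Lipschitz `‖·‖ ≤ 1` far piece is BV); C4 `inClass_farStep` (a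 step at `z₀ = 3/2`), `inClass_farBlock` (`𝟙_{[3/2,2)}`, the multi-far block) |

KILL-word alignment (REF-E C1 / E-13): KILL(B-multi) is OF RECORD — director's word 2026-08-26T18:10:26Z + amendment
18:15:06Z, REF-B1 COUNTERSIGNATURE 18:51:15Z over KILL-CERT v2.4 sha16 96c2304f42278a63 §1 («KILL(B-multi) inside K_multi
GIVEN B-AH (E-014)»); the (L-a.iii) constructor of p3's intake (`Repair.bmultiWord3`/`…4`, RepairIntakeBmulti) maps to this row
(REF-E E-13: «(L-a.iii) far bounded-variation structure, DISCRETE-MEAN currency (theorem E-033), `Re ρ = ½` displayed, no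
slot; row 4 ⊆ it»). The pending KILL(B-len) word's (L-a)/χψ clause is carried by `Repair.lengthsBeyondP_independent` (p463543,
RepairLengthsIndependent — an INDEPENDENCE theorem in the consistency-model currency, deliberately NOT a row here). -/

/-- **`R⁺⁺`, version 5**: version 4 followed by the far bounded-variation family (`familyFarBV`, p463265) — row 20.
[cite: Zhang2022LandauSiegel, §2 (2.16)–(2.20); §7 (7.2); §8 Lemma 8.1] -/
def Rplusplus5 : List DesignFamily := Rplusplus4 ++ [familyFarBV]

/-- **Version 5 is decided**: `rplusplus4_decided` for rows 1–19 and `familyFarBV_decided` (p463265) for row 20;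
nothing re-proved. [cite: Zhang2022LandauSiegel, §2 Props. 2.4–2.6, (2.16)–(2.20), (2.32)–(2.33)] -/
theorem rplusplus5_decided : ClassDecided Rplusplus5 := classDecided_snoc rplusplus4_decided familyFarBV_decided

/-- The families of version 5, by name (the class is EXACTLY these twenty).
[cite: Zhang2022LandauSiegel, §2 (2.32)–(2.33)] -/
theorem mem_rplusplus5_iff (F : DesignFamily) :
    F ∈ Rplusplus5 ↔ F = familyR ∨ F = familyH1 ∨ F = familyTwoPiece ∨ F = familyFarPiece ∨
      F = familyRWide ∨ F = familyRCalc ∨ F = KnifeEdge.familyRoughTwoPiece ∨ F = familyRLengths ∨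
      F = familySmoothLengths ∨ F = familySmoothTop ∨ F = familyTwoPieceJoint ∨ F = familyWallZero ∨
      F = familyWallZeroTop ∨ F = familyInPrintLen ∨ F = KnifeEdge.familyWallBand ∨ F = familyJumpBlockAll ∨
      F = familyDetShift ∨ F = KnifeEdge.familyRoughThreePiece ∨ F = KnifeEdge.familyRoughTwoPieceJoint ∨
      F = familyFarBV := by
  simp only [Rplusplus5, Rplusplus4, Rplusplus3, Rplusplus2, Rplusplus1, Rplus, List.cons_append, List.nil_append,
    List.mem_cons, List.not_mem_nil, or_false]

/-- **Version 4 ⊆ version 5** (list prefix: no family dropped). [cite: Zhang2022LandauSiegel, §2 (2.32)–(2.33)] -/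
theorem rplusplus4_sub_rplusplus5 : ∀ F ∈ Rplusplus4, F ∈ Rplusplus5 :=
  fun _ hF => List.mem_append.2 (Or.inl hF)

/-- `R⁺ ⊆` version 5. [cite: Zhang2022LandauSiegel, §2 (2.32)–(2.33)] -/
theorem rplus_sub_rplusplus5 : ∀ F ∈ Rplus, F ∈ Rplusplus5 :=
  fun F hF => rplusplus4_sub_rplusplus5 F (rplus_sub_rplusplus4 F hF)

/-- Version 5 restricted to version 4, and the slice file's own `R⁺ ++ [familyFarBV]` (`rplus_farBV_decided`) as a
sub-list. [cite: Zhang2022LandauSiegel, §2 (2.32)–(2.33)] -/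
theorem rplusplus5_decided_sublists :
    ClassDecided Rplusplus4 ∧ ClassDecided (Rplus ++ [familyFarBV]) := by
  refine ⟨rplusplus5_decided.mono rplusplus4_sub_rplusplus5, rplusplus5_decided.mono fun F hF => ?_⟩
  rcases List.mem_append.1 hF with h | h
  · exact rplus_sub_rplusplus5 F h
  · exact List.mem_append.2 (Or.inr h)

/-- **Unbundled reading of row 20** (every binder literal): for every far profile of bounded variation, all large `D`,
every real primitive `χ`, under `Re ρ = ½`, no main-order gain from `P^{1+ε}` to `P^{1+δ}`.
[cite: Zhang2022LandauSiegel, §2 (2.16)–(2.20); §8 Lemma 8.1] -/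
theorem rplusplus5_verdict_farBV (c' : ℝ) {δ ε B V : ℝ} {g : ℝ → ℂ} (hε : 0 < ε) (hεδ : ε < δ) (hB : 0 ≤ B)
    (hV : 0 ≤ V) (hgB : ∀ z, ‖g z‖ ≤ B) (hvar : eVariationOn g (Set.Icc 1 (1 + δ)) ≤ ENNReal.ofReal V) :
    Skeleton.ForAllLarge fun D _ χ =>
      (∀ i ∈ Skeleton.idx χ, (i.2).re = 1 / 2) →
        ¬ (Skeleton.bigP D ^ (-(ε / 8)) *
              (discMeanAbs c' χ g ⌈Skeleton.bigP D ^ (1 + ε)⌉₊ + (B + V) ^ 2 * discWeight c' χ) <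
            |discMean c' χ g ⌈Skeleton.bigP D ^ (1 + δ)⌉₊ - discMean c' χ g ⌈Skeleton.bigP D ^ (1 + ε)⌉₊|) :=
  familyFarBV_decided ⟨c', δ, ε, B, V, g⟩ ⟨hε, hεδ, hB, hV, hgB, hvar⟩

/-! ### Version 6 (2026-08-26): the Λ-type block family (B-multi M2), and the KILL(B-multi) intake list ⊆ the class of record

| # | family (decl) | designs, K in words | V (currency) | displayed inputs (kind) | p-id (file) | non-vacuity / tightness / embeddings |
|---|---|---|---|---|---|---|
| 21 | `familyLambdaBlockAll` | `LambdaDesign (u, u′, L, c)`: `KinkedProfile u u′` with `u(1) = 0` (χψ-smooth side-1 bulk), `L : KnifeEdge.LambdaPiece` admissible (`L.Admissible`: order `k ≥ 1`, length `0 < ν ≤ 1`, bounded profile — p459168's binders verbatim; KILL-CERT v2.4 §2 (L-b) «Λ-type blocks k ∈ {1,2}, tops ≤ 1» is the sub-case, the class is WIDER in `k`), balanced amplitude `c` (B-multi M2) | MODEL main-term currency (E-030): `¬ (lambdaBlockMainTerm K X u u′ L c < 0)` for EVERY model world `(K, X)` — world-parametric `familyLambdaBlock K X` packaged kernel-uniformly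 (`familyLambdaBlockAll_iff`) | as WORLD binders: `KnifeEdge.LambdaDiagNonneg K` (E-030, `K_Λ ≥ 0`) · `KnifeEdge.LambdaBlockCS K X` (E-030 in (B1) form); E-030 itself a derivation with step 2 open (INERT by price) — said in p5's docstring | p464018 (`RepairLambdaBlock`) ← p459168, p458738 | threshold `lambdaNull_iff` (Sylvester n = 2), `lambdaDiagNonneg_of_cs`; C4 `inClass_lambdaDesignFeng` (Feng K = 2/3 designs multi-lambda-001/002); tightness `eMultiLambdaCloses_of_indefinite` (p459168); C2: the Λ-free design reduces to row 2's `𝔅(u)` (`lambdaBlockMainTerm_zero`) |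

KILL(B-multi) (of record, KILL-CERT v2.4 96c2304f42278a63, countersigned 18:51:15Z): p3's intake list `Repair.bmultiWord4`
(RepairIntakeBmulti, p461787/p462252/p462825/p463167/p463569: `[familyH1, familyJumpBlockAll, familyWallBand,
familyRoughTwoPiece, familyRLengths] ++ [familyR, familyTwoPieceJoint] ++ [familyRoughThreePiece, familyRoughTwoPieceJoint] ++
[familyFarBV]`) is a SUB-LIST of the class of record (`bmultiWord4_sub_rplusplus6`, referee INTAKE-1 N2), so
`bmultiWord4_decided` is an instance of `rplusplus6_decided` (`rplusplus6_decided_bmultiWord4`); the next intake version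
(`bmultiWord5` with `familyLambdaBlockAll`, `familyGramBlock`) gets the same lemma in the next version here. -/

/-- **`R⁺⁺`, version 6**: version 5 followed by the Λ-type block family for all model worlds
(`familyLambdaBlockAll`, p464018) — row 21. [cite: Zhang2022LandauSiegel, §7 Prop. 7.1 (7.2); §2 (2.32)–(2.33)] -/
def Rplusplus6 : List DesignFamily := Rplusplus5 ++ [familyLambdaBlockAll]

/-- **Version 6 is decided**: `rplusplus5_decided` for rows 1–20 and `familyLambdaBlockAll_decided` (p464018) for row 21;
nothing re-proved. [cite: Zhang2022LandauSiegel, §2 Props. 2.4–2.6, (2.32)–(2.33); §7 (7.2) p.44] -/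
theorem rplusplus6_decided : ClassDecided Rplusplus6 := classDecided_snoc rplusplus5_decided familyLambdaBlockAll_decided

/-- The families of version 6, by name (the class is EXACTLY these twenty-one).
[cite: Zhang2022LandauSiegel, §2 (2.32)–(2.33)] -/
theorem mem_rplusplus6_iff (F : DesignFamily) :
    F ∈ Rplusplus6 ↔ F = familyR ∨ F = familyH1 ∨ F = familyTwoPiece ∨ F = familyFarPiece ∨
      F = familyRWide ∨ F = familyRCalc ∨ F = KnifeEdge.familyRoughTwoPiece ∨ F = familyRLengths ∨
      F = familySmoothLengths ∨ F = familySmoothTop ∨ F = familyTwoPieceJoint ∨ F = familyWallZero ∨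
      F = familyWallZeroTop ∨ F = familyInPrintLen ∨ F = KnifeEdge.familyWallBand ∨ F = familyJumpBlockAll ∨
      F = familyDetShift ∨ F = KnifeEdge.familyRoughThreePiece ∨ F = KnifeEdge.familyRoughTwoPieceJoint ∨
      F = familyFarBV ∨ F = familyLambdaBlockAll := by
  simp only [Rplusplus6, Rplusplus5, Rplusplus4, Rplusplus3, Rplusplus2, Rplusplus1, Rplus, List.cons_append,
    List.nil_append, List.mem_cons, List.not_mem_nil, or_false]

/-- **Version 5 ⊆ version 6** (list prefix: no family dropped). [cite: Zhang2022LandauSiegel, §2 (2.32)–(2.33)] -/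
theorem rplusplus5_sub_rplusplus6 : ∀ F ∈ Rplusplus5, F ∈ Rplusplus6 :=
  fun _ hF => List.mem_append.2 (Or.inl hF)

/-- `R⁺ ⊆` version 6. [cite: Zhang2022LandauSiegel, §2 (2.32)–(2.33)] -/
theorem rplus_sub_rplusplus6 : ∀ F ∈ Rplus, F ∈ Rplusplus6 :=
  fun F hF => rplusplus5_sub_rplusplus6 F (rplus_sub_rplusplus5 F hF)

/-- Version 6 restricted to version 5, and the slice file's own `R⁺ ++ [familyLambdaBlockAll]` (`rplus_lambdaAll_decided`)
as a sub-list. [cite: Zhang2022LandauSiegel, §2 (2.32)–(2.33)] -/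
theorem rplusplus6_decided_sublists :
    ClassDecided Rplusplus5 ∧ ClassDecided (Rplus ++ [familyLambdaBlockAll]) := by
  refine ⟨rplusplus6_decided.mono rplusplus5_sub_rplusplus6, rplusplus6_decided.mono fun F hF => ?_⟩
  rcases List.mem_append.1 hF with h | h
  · exact rplus_sub_rplusplus6 F h
  · exact List.mem_append.2 (Or.inr h)

/-- **The KILL(B-multi) intake list is inside the class of record**: every family of p3's `bmultiWord4`
(RepairIntakeBmulti, KILL-CERT v2.4 96c2304f42278a63) is a family of `Rplusplus6` (referee INTAKE-1 N2).
[cite: Zhang2022LandauSiegel, §2 (2.32)–(2.33); §7 (7.2) p.44] -/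
theorem bmultiWord4_sub_rplusplus6 : ∀ F ∈ bmultiWord4, F ∈ Rplusplus6 := by
  intro F hF
  simp only [bmultiWord4, bmultiWord3, bmultiWord2, bmultiWord, List.cons_append, List.nil_append, List.mem_cons,
    List.not_mem_nil, or_false] at hF
  rw [mem_rplusplus6_iff]
  tauto

/-- … hence the intake theorem `bmultiWord4_decided` is an instance of `rplusplus6_decided` (consistency of the books:
the word's class is decided BECAUSE the class of record is). [cite: Zhang2022LandauSiegel, §2 (2.32)–(2.33); §7 (7.2) p.44] -/
theorem rplusplus6_decided_bmultiWord4 : ClassDecided bmultiWord4 := rplusplus6_decided.mono bmultiWord4_sub_rplusplus6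

/-- **Unbundled reading of row 21** (every binder literal): for every in-class bulk `u` (`u(1) = 0`), admissible Λ-piece
`L`, amplitude `c`, and every model world `(K, X)` with `K_Λ ≥ 0` and the Λ-block Cauchy–Schwarz slot, the model
constant is not negative. [cite: Zhang2022LandauSiegel, §7 Prop. 7.1 (7.2)] -/
theorem rplusplus6_verdict_lambda (u u' : ℝ → ℂ) (L : KnifeEdge.LambdaPiece) (c : ℂ) (hu : KinkedProfile u u')
    (hu1 : u 1 = 0) (hL : L.Admissible) (K : KnifeEdge.LambdaDiag) (X : KnifeEdge.LambdaCross)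
    (hK : KnifeEdge.LambdaDiagNonneg K) (hX : KnifeEdge.LambdaBlockCS K X) :
    ¬ (KnifeEdge.lambdaBlockMainTerm K X u u' L c < 0) :=
  familyLambdaBlockAll_decided ⟨u, u', L, c⟩ ⟨hu, hu1, hL⟩ K X hK hX

/-! ### Version 6, addendum (2026-08-26): both KILL-word intake lists of record are inside the class of record

KILL(B-len) is OF RECORD — ls-lead 2026-08-26T19:19:33Z (director pre-authorised 18:53:49Z), KILL-draft v2.4 sha16
b46628540b6b957c §1 («KILL(B-len) INSIDE 𝒟_len GIVEN B-AH (E-014)»); p3's intake `Repair.blenWord` (RepairIntakeBlen,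
p465008; B-ref-1 intake read PASS 19:44:17Z, REF-E INTAKE-2 PASS 19:58:34Z: the fourteen (L-a) strata, all landed families)
is a SUB-LIST of `Rplusplus6`, as is the KILL(B-multi) intake v5 `Repair.bmultiWord5` (RepairIntakeBmulti Part 10, p465068:
`bmultiWord4 ++ [familyLambdaBlockAll]`). Hence both intake theorems (`blenWord_decided`, `bmultiWord5_decided`) are
instances of `rplusplus6_decided` — the words' classes are decided BECAUSE the class of record is (referee INTAKE-1 N2 /
INTAKE-2). NOT rows and not re-listed here: the sum families `familyBmulti*` / `familyBlen` (they are the words, not the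
union). The (L-b) arithmetic rows of the B-len word (`blenWord2`: Λ-overhang, μψ, ν blocks) and `familyGramBlock` (B-multi
mixed members) join in version 7 when their files land. IMPORT RULE (barrier/ASSIGNMENTS.md S-E-p1-1): this assembly imports
the intake files, never conversely. -/

/-- **The KILL(B-multi) intake list v5 is inside the class of record**: every family of p3's `bmultiWord5`
(`bmultiWord4 ++ [familyLambdaBlockAll]`, p465068) is a family of `Rplusplus6`.
[cite: Zhang2022LandauSiegel, §2 (2.32)–(2.33); §7 (7.2) p.44] -/
theorem bmultiWord5_sub_rplusplus6 : ∀ F ∈ bmultiWord5, F ∈ Rplusplus6 := by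
  intro F hF
  rcases List.mem_append.1 hF with h | h
  · exact bmultiWord4_sub_rplusplus6 F h
  · exact List.mem_append.2 (Or.inr h)

/-- … hence `bmultiWord5_decided` is an instance of `rplusplus6_decided`.
[cite: Zhang2022LandauSiegel, §2 (2.32)–(2.33); §7 (7.2) p.44] -/
theorem rplusplus6_decided_bmultiWord5 : ClassDecided bmultiWord5 := rplusplus6_decided.mono bmultiWord5_sub_rplusplus6

/-- **The KILL(B-len) intake list v1 is inside the class of record**: every family of p3's `blenWord` (RepairIntakeBlen,
p465008 — the fourteen (L-a) strata of `𝒟_len`) is a family of `Rplusplus6`.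
[cite: Zhang2022LandauSiegel, §2 (2.32)–(2.33); §7 Prop 7.1 (7.2) p.44] -/
theorem blenWord_sub_rplusplus6 : ∀ F ∈ blenWord, F ∈ Rplusplus6 := by
  intro F hF
  simp only [blenWord, List.mem_cons, List.not_mem_nil, or_false] at hF
  rw [mem_rplusplus6_iff]
  tauto

/-- … hence `blenWord_decided` is an instance of `rplusplus6_decided` (consistency of the books for the B-len word).
[cite: Zhang2022LandauSiegel, §2 (2.32)–(2.33); §7 Prop 7.1 (7.2) p.44] -/
theorem rplusplus6_decided_blenWord : ClassDecided blenWord := rplusplus6_decided.mono blenWord_sub_rplusplus6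

/-- The B-len intake file's own `R⁺ ++ blenWord` (`rplus_blenWord_decided`) is a sub-list of the class of record too.
[cite: Zhang2022LandauSiegel, §2 (2.32)–(2.33)] -/
theorem rplusplus6_decided_rplus_blenWord : ClassDecided (Rplus ++ blenWord) := by
  refine rplusplus6_decided.mono fun F hF => ?_
  rcases List.mem_append.1 hF with h | h
  · exact rplus_sub_rplusplus6 F h
  · exact blenWord_sub_rplusplus6 F h

/-- **Both words at once**: the union of the two intake lists of record is decided, as a sub-list of `Rplusplus6`.
[cite: Zhang2022LandauSiegel, §2 (2.32)–(2.33); §7 Prop 7.1 (7.2) p.44] -/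
theorem rplusplus6_decided_words : ClassDecided (bmultiWord5 ++ blenWord) := by
  refine rplusplus6_decided.mono fun F hF => ?_
  rcases List.mem_append.1 hF with h | h
  · exact bmultiWord5_sub_rplusplus6 F h
  · exact blenWord_sub_rplusplus6 F h

end Repair

end Literature.NumberTheory.LFunctions.Zhang2022
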